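import Summits.QuantumFields.BalabanUV.T4Continuum.Support.RegionElectricSplitting
import Summits.QuantumFields.BalabanUV.T4Continuum.Support.RegionGaugeResolventSplit

/-!
# T⁴ programme, spine node NE2 (U1a), sub-row Δ1 «NE2⁰-Dirichlet» — DIRECTION SPLITTING: a bond operator without cross-direction entries
# commutes with the direction projections and so does its inverse; THE LOCAL REGION OPERATOR `Δ_loc(Ω)` IS SUCH AN OPERATOR on every
# region without re-entrant contact (in particular on the whole torus)

NE2 formalisation swarm `b2b-balaban-t4-ne2-formalise-*`, LEAF PROVER 07 (gen 11), supplier brick «Δ1-LOC-COMPONENTWISE» (own initiative;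
named as «leaf-07-g11's reserved brick» in leaf-05-g10's memo `t4/T4-EST-NE2-D1-COLLAR-STRUCT.md` §4 (d), journal 2026-08-21 l.24942, and
wanted for the owner's graded well: R47 l.25022 / O16-b l.25177 «your direction-splitting transfers verbatim to `localGW` via `localGW_eq`»;
numerics of record `t4/T4-EST-NE2-D1-COLLAR.md`).

 * §1 GENERIC (any finite bond index type `v` with a direction map `dir : v → Fin d`): the 0/1 diagonal projections `compP dir ν`
   (`Σ_ν compP ν = 1`, idempotent, Hermitian); a matrix INTO `v` whose row `i` reads only bonds of direction `rdir i` has a Gram matrix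
   without cross-direction entries (`gram_apply_eq_zero_of_dir`); a matrix `T` on `v` WITHOUT CROSS-DIRECTION ENTRIES
   (`dir b ≠ dir b′ → T b b′ = 0`) commutes with every `compP dir ν` (`mul_compP_eq_of_apply_eq_zero`), its form splits
   `⟨A, TA⟩ = Σ_ν ⟨A_ν, T A_ν⟩` (`form_eq_sum_compP`), and if `IsUnit T.det` its INVERSE commutes with the projections too
   (`inv_mul_eq_mul_inv_of_commute`, `inv_mul_compP_of_apply_eq_zero`) — the resolvent is componentwise.
 * §2 THE STAR BONDS of a region (`dir b = b.2`): `Idiff μ`, `Wdir μ` (`RegionElectricSplitting`), Bałaban's line averaging `avgR` (a row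
   `(y, ν)` of (1.18) reads only `ν`-bonds) and its Gram matrix have no cross-direction entries.
 * §3 **`regionDeltaLoc_apply_eq_zero_of_ne (hH : AtMostOneNeighbour n M S) : b.2 ≠ b′.2 → Δ_loc b b′ = 0`** — the owner's LOCAL operator
   `regionDeltaLoc = curlRᴴcurlR + gradR·gradRᴴ + a n^d·avgRᴴavgR` (p238371) via leaf-07-g7's ELECTRIC SPLITTING
   `curlRᴴcurlR + gradR·gradRᴴ = Σ_μ Wdir μ` (H1 regions: every product region at `n ≥ 2`, the whole torus) and §2; hence
   `regionDeltaLoc_mul_compP`, `form_regionDeltaLoc_eq_sum`, **`regionDeltaLoc_inv_mul_compP`** (given `IsUnit Δ_loc.det`).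
 * §4 the whole torus is an H1 region (`atMostOneNeighbour_top`, vacuously): `regionDeltaLoc_top_apply_eq_zero_of_ne` with no hypothesis.

Downstream one-liners (separate files, on modules that are proposals at the time of writing): the two-zone `localTZ = regionDeltaLoc S₀ +
a n²·selCᴴselC` (leaf-05-g10 `RegionTwoZoneLocal`; the collar mass is diagonal) and the graded-well `localGW = LapV + a·QvGWᴴQvGW` (owner
O16-b `GradedWellData`; `LapV` and the sub-block line averages are direction-preserving) inherit §1 with `dir = Prod.snd`.

HONEST FRAMING (T4-DAG p. 1).  Model level (`U = 1`, one region / one averaging scale, finite torus); [folklore] finite-dimensional algebra over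
landed modules; nothing printed is asserted; no estimate, no rate; on regions WITH re-entrant contact `Δ_loc` is NOT componentwise (coupling
block of norm `n²`, `t4/T4-EST-NE2-D1-REENTRANT.md` (V1)); NE2 (U1a) NOT proved; spine PROVED 0/9 unchanged; NOT [B9] (3.16)/(3.23)–(3.27) as
printed; NOT infinite volume / mass gap / Clay.  HONEST DEPENDENCY: continuum YM on T⁴ ⇐ BetaPertH ∧ nine spine estimates (0/9 proved);
BetaPertH ⇐ (D1) ∧ (D4) ∧ CAP+tail; G-an2-4 gates asym, D1 and NE2/3/4.  No `sorry`.
-/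

noncomputable section

open scoped BigOperators ComplexConjugate Matrix
open Finset

namespace Summit.QuantumFields.BalabanUV.T4Continuum.RegionLocalComponentwise

open Literature.MathematicalPhysics.QuantumFieldTheory.Balaban1983to89.B5Prop11Plancherel (Tor fine unitVec)
open Literature.MathematicalPhysics.QuantumFieldTheory.Balaban1983to89.B5Block118 (QvOp)
open Summit.QuantumFields.BalabanUV.T4Continuum
open Summit.QuantumFields.BalabanUV.T4Continuum.RegionGaugeFixedVector (starReg curlR gradR avgR)
open Summit.QuantumFields.BalabanUV.T4Continuum.RegionGaugeResolventSplit (regionDeltaLoc regionDeltaLoc_eq)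
open Summit.QuantumFields.BalabanUV.T4Continuum.RegionStarBoundaryCharges (AtMostOneNeighbour)
open Summit.QuantumFields.BalabanUV.T4Continuum.RegionElectricSplitting (Idiff Wdir tcnt electric_splitting)
open Summit.QuantumFields.BalabanUV.Beta.GAN24.DirichletBoxTrace (blockReg)

variable {d : ℕ}

/-! ## §1 Generic direction splitting -/

section Generic

variable {v : Type*} [Fintype v] [DecidableEq v] (dir : v → Fin d)

/-- the 0/1 projection onto the bonds of direction `ν`. [folklore] -/
def compP (ν : Fin d) : Matrix v v ℂ := Matrix.diagonal fun b => if dir b = ν then 1 else 0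

omit [Fintype v] in
/-- entries of `compP`. [folklore] -/
theorem compP_apply (ν : Fin d) (b b' : v) : compP dir ν b b' = if b = b' ∧ dir b = ν then 1 else 0 := by
  unfold compP
  by_cases h : b = b'
  · subst h; by_cases h2 : dir b = ν <;> simp [h2]
  · simp [h]

omit [Fintype v] in
/-- `Σ_ν compP ν = 1`. [folklore] -/
theorem sum_compP : ∑ ν, compP dir ν = (1 : Matrix v v ℂ) := by
  ext b b'
  rw [Matrix.sum_apply]
  simp_rw [compP_apply]
  by_cases h : b = b'
  · subst h
    rw [Finset.sum_eq_single (dir b)]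
    · simp
    · intro ν _ hν; simp [Ne.symm hν]
    · intro h; exact absurd (mem_univ _) h
  · simp [h, Matrix.one_apply_ne h]

/-- `compP ν` is idempotent. [folklore] -/
theorem compP_mul_compP (ν : Fin d) : compP dir ν * compP dir ν = compP dir ν := by
  unfold compP
  rw [Matrix.diagonal_mul_diagonal]
  congr 1; funext b; by_cases h : dir b = ν <;> simp [h]

omit [Fintype v] in
/-- `compP ν` is Hermitian (real diagonal). [folklore] -/
theorem compP_conjTranspose (ν : Fin d) : (compP dir ν)ᴴ = compP dir ν := by
  unfold compP
  rw [Matrix.diagonal_conjTranspose]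
  congr 1; funext b; by_cases h : dir b = ν <;> simp [h]

/-- `compP ν` acting on a field keeps the `ν`-components. [folklore] -/
theorem compP_mulVec (ν : Fin d) (A : v → ℂ) (b : v) : (compP dir ν *ᵥ A) b = if dir b = ν then A b else 0 := by
  unfold compP
  rw [Matrix.mulVec_diagonal]
  by_cases h : dir b = ν <;> simp [h]

omit [Fintype v] [DecidableEq v] in
/-- a matrix INTO the bonds whose row `i` only reads bonds of direction `rdir i` has a Gram matrix without cross-direction entries.
[folklore] -/
theorem gram_apply_eq_zero_of_dir {m : Type*} [Fintype m] (X : Matrix m v ℂ) (rdir : m → Fin d)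
    (hX : ∀ i b, rdir i ≠ dir b → X i b = 0) {b b' : v} (h : dir b ≠ dir b') : (Xᴴ * X) b b' = 0 := by
  rw [Matrix.mul_apply]
  refine Finset.sum_eq_zero fun i _ => ?_
  rw [Matrix.conjTranspose_apply]
  by_cases hi : rdir i = dir b
  · rw [hX i b' (hi ▸ h), mul_zero]
  · rw [hX i b hi, star_zero, zero_mul]

/-- generic: a matrix with an invertible determinant that commutes with `P` has an inverse commuting with `P`. [folklore] -/
theorem inv_mul_eq_mul_inv_of_commute {T P : Matrix v v ℂ} (hU : IsUnit T.det) (hc : T * P = P * T) : T⁻¹ * P = P * T⁻¹ := by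
  have h1 : T⁻¹ * (T * P) * T⁻¹ = T⁻¹ * (P * T) * T⁻¹ := by rw [hc]
  rw [← Matrix.mul_assoc, Matrix.nonsing_inv_mul _ hU, Matrix.one_mul, Matrix.mul_assoc, Matrix.mul_assoc,
    Matrix.mul_nonsing_inv _ hU, Matrix.mul_one] at h1
  exact h1.symm

/-- **A MATRIX WITHOUT CROSS-DIRECTION ENTRIES COMMUTES WITH EVERY DIRECTION PROJECTION.** [folklore] -/
theorem mul_compP_eq_of_apply_eq_zero {T : Matrix v v ℂ} (hT : ∀ b b' : v, dir b ≠ dir b' → T b b' = 0) (ν : Fin d) :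
    T * compP dir ν = compP dir ν * T := by
  ext b b'
  unfold compP
  rw [Matrix.mul_diagonal, Matrix.diagonal_mul]
  by_cases hb : dir b = ν <;> by_cases hb' : dir b' = ν
  · simp [hb, hb']
  · rw [if_neg hb', if_pos hb, mul_zero, one_mul, hT b b' (by rw [hb]; exact Ne.symm hb')]
  · rw [if_pos hb', if_neg hb, mul_one, zero_mul, hT b b' (by rw [hb']; exact hb)]
  · simp [hb, hb']

/-- **… ITS FORM SPLITS DIRECTION BY DIRECTION**: `⟨A, T A⟩ = Σ_ν ⟨A_ν, T A_ν⟩`. [folklore] -/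
theorem form_eq_sum_compP {T : Matrix v v ℂ} (hT : ∀ b b' : v, dir b ≠ dir b' → T b b' = 0) (A : v → ℂ) :
    star A ⬝ᵥ (T *ᵥ A) = ∑ ν, star (compP dir ν *ᵥ A) ⬝ᵥ (T *ᵥ (compP dir ν *ᵥ A)) := by
  have hc : ∀ ν, T *ᵥ (compP dir ν *ᵥ A) = compP dir ν *ᵥ (T *ᵥ A) := fun ν => by
    rw [Matrix.mulVec_mulVec, Matrix.mulVec_mulVec, mul_compP_eq_of_apply_eq_zero dir hT ν]
  have hterm : ∀ ν (b : v),
      star ((compP dir ν *ᵥ A) b) * (T *ᵥ (compP dir ν *ᵥ A)) b = if dir b = ν then star (A b) * (T *ᵥ A) b else 0 := fun ν b => by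
    rw [hc ν, compP_mulVec, compP_mulVec]
    by_cases h : dir b = ν
    · rw [if_pos h, if_pos h, if_pos h]
    · rw [if_neg h, if_neg h, if_neg h, star_zero, zero_mul]
  simp only [dotProduct, Pi.star_apply]
  simp_rw [hterm]
  rw [Finset.sum_comm]
  refine Finset.sum_congr rfl fun b _ => ?_
  rw [Finset.sum_ite_eq, if_pos (mem_univ _)]

/-- **… AND ITS INVERSE COMMUTES WITH THE DIRECTION PROJECTIONS** (the resolvent is componentwise). [folklore] -/
theorem inv_mul_compP_of_apply_eq_zero {T : Matrix v v ℂ} (hT : ∀ b b' : v, dir b ≠ dir b' → T b b' = 0) (hU : IsUnit T.det)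
    (ν : Fin d) : T⁻¹ * compP dir ν = compP dir ν * T⁻¹ :=
  inv_mul_eq_mul_inv_of_commute hU (mul_compP_eq_of_apply_eq_zero dir hT ν)

omit [Fintype v] [DecidableEq v] in
/-- a sum of two matrices without cross-direction entries has none. [folklore] -/
theorem add_apply_eq_zero_of_apply_eq_zero {T T' : Matrix v v ℂ} (hT : ∀ b b' : v, dir b ≠ dir b' → T b b' = 0)
    (hT' : ∀ b b' : v, dir b ≠ dir b' → T' b b' = 0) {b b' : v} (h : dir b ≠ dir b') : (T + T') b b' = 0 := by
  rw [Matrix.add_apply, hT b b' h, hT' b b' h, add_zero]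

omit [Fintype v] [DecidableEq v] in
/-- a scalar multiple of a matrix without cross-direction entries has none. [folklore] -/
theorem smul_apply_eq_zero_of_apply_eq_zero {T : Matrix v v ℂ} (c : ℂ) (hT : ∀ b b' : v, dir b ≠ dir b' → T b b' = 0)
    {b b' : v} (h : dir b ≠ dir b') : (c • T) b b' = 0 := by
  rw [Matrix.smul_apply, hT b b' h, smul_zero]

end Generic

/-! ## §2 The star bonds of a region: direction preservation of the building blocks -/

section Star

variable (n : ℕ) [NeZero n] (M : Fin d → ℕ) [hM : ∀ μ, NeZero (M μ)] (a : ℝ) (S : Tor M → Prop) [DecidablePred S]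

/-- the direction of a star bond. [folklore] -/
def sdir : {b // starReg n M S b} → Fin d := fun b => b.1.2

/-- `Idiff μ` preserves the direction: row `y` reads only `y` and `y + e_μ`. [folklore] -/
theorem Idiff_apply_eq_zero_of_ne (μ : Fin d) {y b' : {b // starReg n M S b}} (h : y.1.2 ≠ b'.1.2) : Idiff n M S μ y b' = 0 := by
  unfold Idiff
  by_cases hs : starReg n M S (y.1.1 + unitVec (fine n M) μ, y.1.2)
  · rw [dif_pos hs]
    have h1 : b' ≠ ⟨(y.1.1 + unitVec (fine n M) μ, y.1.2), hs⟩ := by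
      intro hb; apply h; rw [hb]
    have h2 : b' ≠ y := by intro hb; exact h (congrArg (fun b : {b // starReg n M S b} => b.1.2) hb).symm
    simp [h1, h2]
  · rw [dif_neg hs]

/-- `Wdir μ` has no cross-direction entries. [folklore] -/
theorem Wdir_apply_eq_zero_of_ne (μ : Fin d) {b b' : {b // starReg n M S b}} (h : b.1.2 ≠ b'.1.2) : Wdir n M S μ b b' = 0 := by
  unfold Wdir
  rw [Matrix.add_apply, gram_apply_eq_zero_of_dir (sdir n M S) (Idiff n M S μ) (sdir n M S)
      (fun y c hy => Idiff_apply_eq_zero_of_ne n M S μ hy) h]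
  have hne : b ≠ b' := by intro hb; exact h (congrArg (fun b : {b // starReg n M S b} => b.1.2) hb)
  rw [Matrix.diagonal_apply_ne _ hne, add_zero]

omit [DecidablePred S] in
/-- Bałaban's line averaging preserves the direction: the row `(y, ν)` of (1.18) reads only `ν`-bonds.
[cite: Balaban1984PropagatorsI, (1.18) p.20 (shape)] [folklore] -/
theorem avgR_apply_eq_zero_of_ne {i : Tor M × Fin d} {b : {b // starReg n M S b}} (h : i.2 ≠ b.1.2) : avgR n M S i b = 0 := by
  unfold avgR
  rw [Matrix.submatrix_apply]
  unfold QvOp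
  simp [Ne.symm h]

omit [DecidablePred S] in
/-- the line-averaging Gram matrix has no cross-direction entries. [folklore] -/
theorem avgR_gram_apply_eq_zero_of_ne {b b' : {b // starReg n M S b}} (h : b.1.2 ≠ b'.1.2) :
    ((avgR n M S)ᴴ * avgR n M S) b b' = 0 :=
  gram_apply_eq_zero_of_dir (sdir n M S) (avgR n M S) (fun i => i.2) (fun _ _ hi => avgR_apply_eq_zero_of_ne n M S hi) h

/-! ## §3 The local operator is componentwise on H1 regions; so is its resolvent -/

/-- **`Δ_loc` HAS NO CROSS-DIRECTION ENTRIES ON A REGION WITHOUT RE-ENTRANT CONTACT** (H1 = `AtMostOneNeighbour`): by the electric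
splitting `curlRᴴcurlR + gradR·gradRᴴ = Σ_μ Wdir μ` and the direction preservation of `Wdir μ` and of the line averaging.
[cite: Balaban1985BackgroundPropagators, (3.26) p.395 (shape: Δ_a at U = 1, R ↦ 1)] [folklore] -/
theorem regionDeltaLoc_apply_eq_zero_of_ne (hH : AtMostOneNeighbour n M S) {b b' : {b // starReg n M S b}} (h : b.1.2 ≠ b'.1.2) :
    regionDeltaLoc n M a S b b' = 0 := by
  have hW : (∑ μ, Wdir n M S μ) b b' = 0 := by
    rw [Matrix.sum_apply]
    exact Finset.sum_eq_zero fun μ _ => Wdir_apply_eq_zero_of_ne n M S μ h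
  rw [regionDeltaLoc_eq, electric_splitting n M S hH, Matrix.add_apply, Matrix.smul_apply, hW,
    avgR_gram_apply_eq_zero_of_ne n M S h, smul_zero, add_zero]

/-- **`Δ_loc` COMMUTES WITH THE DIRECTION PROJECTIONS** on H1 regions. [folklore] -/
theorem regionDeltaLoc_mul_compP (hH : AtMostOneNeighbour n M S) (ν : Fin d) :
    regionDeltaLoc n M a S * compP (sdir n M S) ν = compP (sdir n M S) ν * regionDeltaLoc n M a S :=
  mul_compP_eq_of_apply_eq_zero (sdir n M S) (fun _ _ h => regionDeltaLoc_apply_eq_zero_of_ne n M a S hH h) ν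

/-- **THE LOCAL RESOLVENT IS COMPONENTWISE** on H1 regions: `G̃ * compP ν = compP ν * G̃` whenever `Δ_loc` is invertible (e.g. by
`RegionLocalInjectedPairing.coercive_regionDeltaLoc_lev_box` on boxes). [folklore] -/
theorem regionDeltaLoc_inv_mul_compP (hH : AtMostOneNeighbour n M S) (hU : IsUnit (regionDeltaLoc n M a S).det) (ν : Fin d) :
    (regionDeltaLoc n M a S)⁻¹ * compP (sdir n M S) ν = compP (sdir n M S) ν * (regionDeltaLoc n M a S)⁻¹ :=
  inv_mul_compP_of_apply_eq_zero (sdir n M S) (fun _ _ h => regionDeltaLoc_apply_eq_zero_of_ne n M a S hH h) hU ν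

/-- the form of `Δ_loc` splits direction by direction on H1 regions. [folklore] -/
theorem form_regionDeltaLoc_eq_sum (hH : AtMostOneNeighbour n M S) (A : {b // starReg n M S b} → ℂ) :
    star A ⬝ᵥ (regionDeltaLoc n M a S *ᵥ A)
      = ∑ ν, star (compP (sdir n M S) ν *ᵥ A) ⬝ᵥ (regionDeltaLoc n M a S *ᵥ (compP (sdir n M S) ν *ᵥ A)) :=
  form_eq_sum_compP (sdir n M S) (fun _ _ h => regionDeltaLoc_apply_eq_zero_of_ne n M a S hH h) A

/-! ## §4 The whole torus is an H1 region -/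

omit [DecidablePred S] in
/-- the whole torus (`S = ⊤`) has no exterior sites, so H1 holds vacuously. [folklore] -/
theorem atMostOneNeighbour_top : AtMostOneNeighbour n M (fun _ : Tor M => True) := by
  intro x hx
  exact absurd trivial hx

/-- on the whole torus `Δ_loc` has no cross-direction entries, unconditionally. [folklore] -/
theorem regionDeltaLoc_top_apply_eq_zero_of_ne {b b' : {b // starReg n M (fun _ : Tor M => True) b}} (h : b.1.2 ≠ b'.1.2) :
    regionDeltaLoc n M a (fun _ : Tor M => True) b b' = 0 :=
  regionDeltaLoc_apply_eq_zero_of_ne n M a _ (atMostOneNeighbour_top n M) h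

end Star

end Summit.QuantumFields.BalabanUV.T4Continuum.RegionLocalComponentwise

end
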